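import Summits.QuantumFields.BalabanUV.Beta.KernelWardResidual
import Summits.QuantumFields.BalabanUV.Beta.KernelWardSwap
import Summits.QuantumFields.BalabanUV.Beta.KernelWardSwapResponse

/-!
# `BalabanUV.Beta.KernelWardSymAssembly` — binder row D1, (L4) W-side: the second-order Ward socket `hWd` ASSEMBLED for the SYMMETRISED carrier
# `W2SymOfK` (an2's literal shape): direct half (an1's `KernelWardResidual`) + swapped half (leaf-10's `KernelWardSwap`/`KernelWardSwapResponse`)
# (β sub-cell, D1 formalisation swarm, unit `b2b-balaban-beta-d1-formalise-leaf-10`, gen 2; CLAIM «D1-hW-L4-SWAP», assembly)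

NOT IN PRINT; OUR BOOKKEEPING.  HONEST FRAMING (cell contract, verbatim): «discharging `BetaPertH` makes Bałaban's UV stability
UNCONDITIONAL — a real constructive-QFT result; it is NOT the continuum limit and NOT the Clay problem.»  HONEST DEPENDENCY (verbatim):
«continuum YM on T⁴ ⇐ BetaPertH ∧ nine spine estimates (0/9 proved); BetaPertH ⇐ (D1) ∧ (D4) ∧ CAP+tail; G-an2-4 gates asym, D1 and
NE2/3/4.»  [folklore] kernel algebra; every table law, the first-order law, (hH)/(hMw)/(hoff), the relative rules and `[E, X y] = 0` are
DISPLAYED HYPOTHESES; instantiates NO binder of the β-function wall; no `[cite:]`, no `def`, no `def … : Prop`; NOT D1, NOT `BetaPertH`,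
NOT continuum, NOT Clay.

## What

`W2SymOfK K N S M S₂ M₂ μ y ν y′ = ½ • (W2OfK … μ y ν y′ + W2OfK … ν y′ μ y)`.  Under the (μ,y)-divergence the DIRECT ordering is an1's
`divW_W2OfK_eq_conjV_add_residual` (`= conjV (dM K N S M ν y′) (X y) + 𝒩 y ν y′`); the SWAPPED ordering (`divW_W2OfK_swap_eq_conjV_add_residual`
below) is `conjV (dM K N S M ν y′) (X y) + 𝒩″ y ν y′` with **`𝒩″ y ν y′ := dM K N (R″ y) (RM y) ν y′ + dM (conjV K (X y)) N S M ν y′`** (second-slot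
law of `S₂` with remainder `R″`, the same `M₂` law, and the ROTATED first-order vertex from the swapped response).  Hence
**`divW_W2SymOfK_eq_conjV_add_residuals`**: `divW (W2SymOfK K N S M S₂ M₂) y ν y′ = conjV (dM K N S M ν y′) (X y) + ½ • (𝒩 y ν y′ + 𝒩″ y ν y′)` —
the hW socket `hWd` for the symmetrised carrier with `X₂ := 0` and `Nr := ½ • (𝒩 + 𝒩″)`; `Nr`'s localisation and tadpole-nullity are an1's
`KernelWardResidual` §4 for `𝒩` and, for `𝒩″`, the same engine (rows of `R″`, `RM` parity-odd; the rotated vertex carries scalar-weighted rows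
of `S`, `M`).  NO swap symmetry of the literal bi-tables is used.
-/

noncomputable section

open Finset
open scoped BigOperators
open Literature.MathematicalPhysics.QuantumFieldTheory
open Literature.MathematicalPhysics.QuantumFieldTheory.Balaban1983to89
open Literature.MathematicalPhysics.QuantumFieldTheory.Balaban1983to89.Beta
open B6BondElimination (unitVec)
open ExpKernelCalculus (MKer Decays BiLoc VertexFamily comp)
open KernelWard (divV divW bdd_of_biLoc)
open AffineAveraging (Site box toSite)
open OneStepResolventKernel (Fib wsum LocStencil)
open OneStepKernelFamily (colH vertexOfK)
open InterLevelTransport (cwsum)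
open SecondOrderResponse (colM vertexOfM dM K2OfK vertex2OfK mixOfK W2OfK W2SymOfK vertexFamily_dM)
open Summit.QuantumFields.BalabanUV.Beta.TameKernelCalculus
open Summit.QuantumFields.BalabanUV.Beta.ChartConjugation (conjV)
open Summit.QuantumFields.BalabanUV.Beta.ChartConjugationRelative (RelInv)
open Summit.QuantumFields.BalabanUV.Beta.ChartConjugationReflection (abs_le_of_locStencil)
open Summit.QuantumFields.BalabanUV.Beta.KernelWardRelative (gaugeWt)
open Summit.QuantumFields.BalabanUV.Beta.WardLocusSecondOrder (abs_vertexOfK_le abs_vertexOfM_le)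
open Summit.QuantumFields.BalabanUV.Beta.KernelWardCoarseExchange (comp_add_of_bdd add_comp_of_bdd)
open Summit.QuantumFields.BalabanUV.Beta.KernelWardMixedLaw (divW_mixOfK_of_tableLaw)
open Summit.QuantumFields.BalabanUV.Beta.KernelWardResidual (divW_W2OfK_eq_conjV_add_residual)
open Summit.QuantumFields.BalabanUV.Beta.KernelWardSwap (divW_vertex2OfK_swap_of_tableLaw)
open Summit.QuantumFields.BalabanUV.Beta.KernelWardSwapResponse (divW_resp_swap_of_law)

namespace Summit.QuantumFields.BalabanUV.Beta.KernelWardSymAssembly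

variable {d N : ℕ} [NeZero N]

/-- [folklore] **THE SWAPPED ORDERING, ASSEMBLED**: under (hH), (hMw), the SECOND-slot law of `S₂` (remainder `R″`), the first-slot law of `M₂`
(remainder `RM`), the FIRST-ORDER law `divV (dM K N S M) y = conjV 𝕄 (X y)` and the relative rules:
`divW (μ y ν y′ ↦ W2OfK K N S M S₂ M₂ ν y′ μ y) y ν y′ = conjV (dM K N S M ν y′) (X y) + (dM K N (R″ y) (RM y) ν y′ + dM (conjV K (X y)) N S M ν y′)`. -/
theorem divW_W2OfK_swap_eq_conjV_add_residual {K 𝕄 E : MKer (d + 1) (Fib d)} {C m : ℝ} (hK : Decays K C m) (hC : 0 ≤ C) (hm : 0 < m)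
    (h𝕄 : Spr 𝕄) (hE : Spr E) (hR : RelInv K 𝕄 E)
    {S : Fin (d + 1) → Site (d + 1) → MKer (d + 1) (Fib d)} {Cs : ℝ} (hS : LocStencil S Cs m)
    {M : Fin (d + 1) → Site (d + 1) → MKer (d + 1) (Fib d)} {CM : ℝ} (hM : VertexFamily M N CM m)
    {S₂ : Fin (d + 1) → Site (d + 1) → Fin (d + 1) → Site (d + 1) → MKer (d + 1) (Fib d)} {B₂ : ℝ}
    (hB₂ : ∀ κ u κ' u' x z a b, |S₂ κ u κ' u' x z a b| ≤ B₂)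
    {M₂ : Fin (d + 1) → Site (d + 1) → Fin (d + 1) → Site (d + 1) → MKer (d + 1) (Fib d)} {B₂' : ℝ}
    (hB₂' : ∀ κ u ρ w x z a b, |M₂ κ u ρ w x z a b| ≤ B₂') (cH : ℝ)
    (hH : ∀ (y : Site (d + 1)) (κ' : Fin (d + 1)) (u : Site (d + 1)),
      ∑ μ, (colH K N μ (y - unitVec μ) κ' u - colH K N μ y κ' u) = cH * gaugeWt N y κ' u)
    (hMw : ∀ (y : Site (d + 1)) (ρ : Fin (d + 1)) (w : Site (d + 1)), ∑ μ, (colM K N μ (y - unitVec μ) ρ w - colM K N μ y ρ w) = 0)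
    {X : Site (d + 1) → MKer (d + 1) (Fib d)} (hX : ∀ y, Spr (X y)) (hXl : ∀ y, Loc (X y)) (hEX : ∀ y, comp E (X y) = comp (X y) E)
    (hD : ∀ y, divV (dM K N S M) y = conjV 𝕄 (X y))
    {R'' : Site (d + 1) → Fin (d + 1) → Site (d + 1) → MKer (d + 1) (Fib d)} {BR'' : ℝ} (hR''b : ∀ y κ u x z a b, |R'' y κ u x z a b| ≤ BR'')
    {RM : Site (d + 1) → Fin (d + 1) → Site (d + 1) → MKer (d + 1) (Fib d)} {BR' : ℝ} (hRMb : ∀ y ρ w x z a b, |RM y ρ w x z a b| ≤ BR')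
    (hS₂'' : ∀ (y : Site (d + 1)) (κ : Fin (d + 1)) (u : Site (d + 1)),
      cH • ∑ v ∈ box (d + 1) N, divV (S₂ κ u) ((N : ℤ) • y + toSite v) = comp (S κ u) (X y) - comp (X y) (S κ u) + R'' y κ u)
    (hM₂ : ∀ (y : Site (d + 1)) (ρ : Fin (d + 1)) (w : Site (d + 1)),
      cH • ∑ v ∈ box (d + 1) N, divV (fun κ u => M₂ κ u ρ w) ((N : ℤ) • y + toSite v) =
        comp (M ρ w) (X y) - comp (X y) (M ρ w) + RM y ρ w)
    (y : Site (d + 1)) (ν : Fin (d + 1)) (y' : Site (d + 1)) :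
    divW (fun μ y ν y' => W2OfK K N S M S₂ M₂ ν y' μ y) y ν y' =
      conjV (dM K N S M ν y') (X y) + (dM K N (R'' y) (RM y) ν y' + dM (conjV K (X y)) N S M ν y') := by
  have hK' : ∃ δ C : ℝ, 0 < δ ∧ 0 ≤ C ∧ Decays K C δ := ⟨m, C, hm, hC, hK⟩
  have hMb : ∀ ρ w x z a b, |M ρ w x z a b| ≤ CM := fun ρ w x z a b => bdd_of_biLoc (hM ρ w) hm.le x z a b
  -- `divW` is additive over the four pieces of the swapped carrier
  have eW : divW (fun μ y ν y' => W2OfK K N S M S₂ M₂ ν y' μ y) y ν y' =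
      divW (fun μ y ν y' => vertex2OfK K N S₂ ν y' μ y) y ν y' + divW (fun μ y ν y' => mixOfK K N M₂ ν y' μ y) y ν y'
        + divW (mixOfK K N M₂) y ν y' + divW (fun μ y ν y' => dM (K2OfK K N S M μ y) N S M ν y') y ν y' := by
    simp only [KernelWard.divW, ← Finset.sum_add_distrib]
    refine Finset.sum_congr rfl fun μ _ => ?_
    simp only [SecondOrderResponse.W2OfK]
    abel
  rw [eW, divW_vertex2OfK_swap_of_tableLaw hK' hS hm hB₂ cH hH hX hR''b hS₂'' y ν y',
    KernelWardMColumn.divW_mixOfK_swap_eq_zero hK' hMw hB₂' y ν y', add_zero,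
    divW_mixOfK_of_tableLaw hK' hMb hB₂' cH hH hX hRMb hM₂ y ν y',
    divW_resp_swap_of_law hK hC hm h𝕄 hE hR hS hM hXl hEX hD y ν y']
  -- regroup the two commutators into `conjV (dM …) (X y)` (bounded vertices ⇒ `comp` distributes)
  have hCs : ∀ κ u x z a b, |S κ u x z a b| ≤ Cs := abs_le_of_locStencil hS hm.le
  have hVK : ∀ x z a b, |vertexOfK K N S ν y' x z a b| ≤ ∑ κ, (∑' u, |colH K N ν y' κ u|) * Cs :=
    fun x z a b => abs_vertexOfK_le hK' hCs ν y' x z a b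
  have hVM : ∀ x z a b, |vertexOfM K N M ν y' x z a b| ≤ ∑ ρ, (∑' w, |colM K N ν y' ρ w|) * CM :=
    fun x z a b => abs_vertexOfM_le hK' hMb ν y' x z a b
  have e1 : comp (X y) (dM K N S M ν y') = comp (X y) (vertexOfK K N S ν y') + comp (X y) (vertexOfM K N M ν y') := by
    unfold SecondOrderResponse.dM; exact comp_add_of_bdd (hX y) hVK hVM
  have e2 : comp (dM K N S M ν y') (X y) = comp (vertexOfK K N S ν y') (X y) + comp (vertexOfM K N M ν y') (X y) := by
    unfold SecondOrderResponse.dM; exact add_comp_of_bdd (hX y) hVK hVM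
  have e3 : dM K N (R'' y) (RM y) ν y' = vertexOfK K N (R'' y) ν y' + vertexOfM K N (RM y) ν y' := rfl
  unfold ChartConjugation.conjV
  rw [e1, e2, e3]
  abel

/-- [folklore] **THE SECOND-ORDER WARD SOCKET FOR THE SYMMETRISED CARRIER, ASSEMBLED**: with an1's direct-ordering residual `𝒩` (the
expression of `KernelWardResidual.divW_W2OfK_eq_conjV_add_residual`) and the swapped residual `𝒩″ := dM K N (R″ y) (RM y) ν y′ + dM (conjV K (X y)) N S M ν y′`:
`divW (W2SymOfK K N S M S₂ M₂) y ν y′ = conjV (dM K N S M ν y′) (X y) + ½ • (𝒩 y ν y′ + 𝒩″ y ν y′)`.  Every law is a displayed hypothesis. -/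
theorem divW_W2SymOfK_eq_conjV_add_residuals {K 𝕄 E : MKer (d + 1) (Fib d)} {C m : ℝ} (hK : Decays K C m) (hC : 0 ≤ C) (hm : 0 < m)
    (h𝕄 : Spr 𝕄) (hE : Spr E) (hR : RelInv K 𝕄 E)
    {S : Fin (d + 1) → Site (d + 1) → MKer (d + 1) (Fib d)} {Cs : ℝ} (hS : LocStencil S Cs m)
    {M : Fin (d + 1) → Site (d + 1) → MKer (d + 1) (Fib d)} {CM : ℝ} (hM : VertexFamily M N CM m)
    {S₂ : Fin (d + 1) → Site (d + 1) → Fin (d + 1) → Site (d + 1) → MKer (d + 1) (Fib d)} {B₂ : ℝ}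
    (hB₂ : ∀ κ u κ' u' x z a b, |S₂ κ u κ' u' x z a b| ≤ B₂)
    {M₂ : Fin (d + 1) → Site (d + 1) → Fin (d + 1) → Site (d + 1) → MKer (d + 1) (Fib d)} {B₂' : ℝ}
    (hB₂' : ∀ κ u ρ w x z a b, |M₂ κ u ρ w x z a b| ≤ B₂') (cH : ℝ)
    (hH : ∀ (y : Site (d + 1)) (κ' : Fin (d + 1)) (u : Site (d + 1)),
      ∑ μ, (colH K N μ (y - unitVec μ) κ' u - colH K N μ y κ' u) = cH * gaugeWt N y κ' u)
    (hMw : ∀ (y : Site (d + 1)) (ρ : Fin (d + 1)) (w : Site (d + 1)), ∑ μ, (colM K N μ (y - unitVec μ) ρ w - colM K N μ y ρ w) = 0)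
    (hoff : ∀ (x : Site (d + 1)), Literature.Probability.LatticeModels.Torus.proj N x ≠ 0 →
      ∀ (z : Site (d + 1)) (ρ μ : Fin (d + 1)), K x z (Sum.inr ρ) (Sum.inr μ) = 0)
    {X : Site (d + 1) → MKer (d + 1) (Fib d)} (hX : ∀ y, Spr (X y)) (hXl : ∀ y, Loc (X y)) (hEX : ∀ y, comp E (X y) = comp (X y) E)
    (hD : ∀ y, divV (dM K N S M) y = conjV 𝕄 (X y))
    {R : Site (d + 1) → Fin (d + 1) → Site (d + 1) → MKer (d + 1) (Fib d)} {BR : ℝ} (hRb : ∀ y κ u x z a b, |R y κ u x z a b| ≤ BR)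
    {R'' : Site (d + 1) → Fin (d + 1) → Site (d + 1) → MKer (d + 1) (Fib d)} {BR'' : ℝ} (hR''b : ∀ y κ u x z a b, |R'' y κ u x z a b| ≤ BR'')
    {RM : Site (d + 1) → Fin (d + 1) → Site (d + 1) → MKer (d + 1) (Fib d)} {BR' : ℝ} (hRMb : ∀ y ρ w x z a b, |RM y ρ w x z a b| ≤ BR')
    (hS₂ : ∀ (y : Site (d + 1)) (κ' : Fin (d + 1)) (u' : Site (d + 1)),
      cH • ∑ v ∈ box (d + 1) N, divV (fun κ u => S₂ κ u κ' u') ((N : ℤ) • y + toSite v) =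
        comp (S κ' u') (X y) - comp (X y) (S κ' u') + R y κ' u')
    (hS₂'' : ∀ (y : Site (d + 1)) (κ : Fin (d + 1)) (u : Site (d + 1)),
      cH • ∑ v ∈ box (d + 1) N, divV (S₂ κ u) ((N : ℤ) • y + toSite v) = comp (S κ u) (X y) - comp (X y) (S κ u) + R'' y κ u)
    (hM₂ : ∀ (y : Site (d + 1)) (ρ : Fin (d + 1)) (w : Site (d + 1)),
      cH • ∑ v ∈ box (d + 1) N, divV (fun κ u => M₂ κ u ρ w) ((N : ℤ) • y + toSite v) =
        comp (M ρ w) (X y) - comp (X y) (M ρ w) + RM y ρ w)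
    (y : Site (d + 1)) (ν : Fin (d + 1)) (y' : Site (d + 1)) :
    divW (W2SymOfK K N S M S₂ M₂) y ν y' =
      conjV (dM K N S M ν y') (X y) + (1 / 2 : ℝ) • (
        (dM K N (R y) (RM y) ν y'
          - cH • (∑ κ, wsum (fun u => ∑' x₂, ∑ κ₂,
              comp K (dM K N S M ν y') u x₂ (Sum.inl κ) (Sum.inl κ₂) * gaugeWt N y κ₂ x₂) (S κ)
            + ∑ ρ, cwsum N (fun w => ∑' x₂, ∑ κ₂,
              comp K (dM K N S M ν y') ((N : ℤ) • w) x₂ (Sum.inr ρ) (Sum.inl κ₂) * gaugeWt N y κ₂ x₂) (M ρ)))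
        + (dM K N (R'' y) (RM y) ν y' + dM (conjV K (X y)) N S M ν y')) := by
  -- `divW (W2SymOfK …) = ½ • (divW (W2OfK …) + divW (swapped W2OfK …))`
  have eS : divW (W2SymOfK K N S M S₂ M₂) y ν y' =
      (1 / 2 : ℝ) • (divW (W2OfK K N S M S₂ M₂) y ν y' + divW (fun μ y ν y' => W2OfK K N S M S₂ M₂ ν y' μ y) y ν y') := by
    simp only [KernelWard.divW, SecondOrderResponse.W2SymOfK, ← Finset.sum_add_distrib, Finset.smul_sum]
    refine Finset.sum_congr rfl fun μ _ => ?_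
    rw [← smul_sub]
    congr 1
    abel
  rw [eS, divW_W2OfK_eq_conjV_add_residual hK hC hm hS hM hB₂ hB₂' cH hH hMw hoff hX hRb hRMb hS₂ hM₂ y ν y',
    divW_W2OfK_swap_eq_conjV_add_residual hK hC hm h𝕄 hE hR hS hM hB₂ hB₂' cH hH hMw hX hXl hEX hD hR''b hRMb hS₂'' hM₂ y ν y']
  -- `½ • ((A + B) + (A + C)) = A + ½ • (B + C)`
  set A := conjV (dM K N S M ν y') (X y)
  rw [show ∀ (B C' : MKer (d + 1) (Fib d)), (1 / 2 : ℝ) • (A + B + (A + C')) = A + (1 / 2 : ℝ) • (B + C') from fun B C' => by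
    funext x z a b; simp only [Pi.smul_apply, Pi.add_apply, smul_eq_mul]; ring]

end Summit.QuantumFields.BalabanUV.Beta.KernelWardSymAssembly

end
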